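import Mathlib
import HarnessLib
import HarnessLib.Audit
import Summits.QuantumAdvantage.Statement
import Literature.Computability.QuantumComplexity.JonesPolynomial
import Literature.Computability.QuantumComplexity.Forrelation
import HarnessLib.Audit.Status.Attr

/-!
Route: PromiseLift

# Route QuantumAdvantage/PromiseLift — the promise→language lift: S ⟺ X ∧ PL, PL through a
PromiseBQP-complete BQP LANGUAGE (Jones/TQFT face #4), certified white-box by the in-tree
PromiseLiftRelativization barrier

It suffices to show X ∧ PL, where X = PlThesis — textbook promise-BQP is not contained in textbook
promise-BPP, ¬(PromiseBQP ⊆ PromiseBPP') — and PL = PlLift — the promise→language LIFT 'BQP ⊆ BPP →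
PromiseBQP ⊆ PromiseBPP''. The factoring is EXACT: closes (X, PL) gives S by contraposition (two
lines of logic, certified), S → X is the provable-now support PlConverseR and S → PL holds
vacuously, so S ⟺ X ∧ PL. X is the consensus promise-level conjecture (hypothesis-grade: X ⟹ PP ⊄
BPP ⟹ P ≠ PSPACE; auto-crux, rank 0) with two typed, provably equivalent faces — 'AJL Jones
approximation at e^{2πi/5} ∉ prBPP' and 'poly-fold white-box Forrelation ∉ prBPP' (supports
PlXIffJonesNotPromiseBPP, PlXIffKForrelationNotPromiseBPPR; both completeness theorems are PROVED in
the tree). PL ≡ (X → S) is the route's own open content and is attacked through its only known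
non-vacuous road, the COMPLETE-LANGUAGE statement #3 PlPromiseIsLift, 'PromiseBQP ⊆ promiseLift BQP'
(every PromiseBQP promise problem is separated by a BQP LANGUAGE; = 'BQP has a PromiseBQP-complete
language'), and its concrete TQFT face #4 PlJonesExtends, 'the Aharonov–Jones–Landau plat-closure
promise problem jonesApproxProblem is the restriction of a BQP language' (#4 → #3 → PL by proved
glue supports PlPromiseIsLiftOfJonesExtends, PlLiftOfPromiseIsLift). Since rev 4 the tree PROVES
that PL, #3 and the glue #4 → PL admit no relativizing proof
(Literature.Barriers.QuantumAdvantage.PromiseLiftRelativization.holds: an oracle A = K ⊕ G with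
BQP^A ⊆ BPP^A and PromiseBQP^A ⊄ PromiseBPP'^A), so the line is, precisely: X plus a WHITE-BOX
construction of one BQP language separating one PromiseBQP-complete problem. Linked card:
canonical-solutions-lift (#3 ⟺ pseudo-deterministic quantum amplitude estimation).
Lean: `¬ (Literature.Computability.Cryptography.PromiseBQP ⊆
Literature.Computability.Complexity.PromiseBPP') ∧ (Literature.Computability.Cryptography.BQP ⊆
Literature.Computability.Complexity.BPP → Literature.Computability.Cryptography.PromiseBQP ⊆
Literature.Computability.Complexity.PromiseBPP')`
Assembly: deciding theorem `closes (hX : PlThesis) (hL : PlLift) : QuantumAdvantage` — were the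
summit false, every BQP language would be in BPP, so PL gives PromiseBQP ⊆ PromiseBPP',
contradicting X (by_contra; certified native-ok by #h21_check_closes, axioms
propext/Classical.choice/Quot.sound). The item `Assembly` (0249) is the same implication uncurried,
PlLift → PlThesis → QuantumAdvantage, provable now.

Rationale: WHY THIS LINE. Almost all structural evidence for quantum advantage lives at the PROMISE level:
PromiseBQP has complete promise problems — additive approximation of the plat-closure Jones
polynomial at e^{2πi/5} (AharonovJonesLandau2009 Thm 1.2; FreedmanLarsenWang2002; AharonovArad2011
Thm 1.1/3.1: TQFT, density of the Jones representation), explicit poly-fold FORRELATION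
(AaronsonAmbainis2018 §6 Prop 6, Thm 25: Boolean Fourier analysis), and the lists of Wocjan–Zhang
(arXiv:quant-ph/0606179) and Zhang 2012 (doi:10.1007/978-3-540-92910-9_46) — while BQP, a semantic
class, is not known to have complete LANGUAGES (AroraBarak2009 §7.5.3; GoldreichPromise2006 §1.3(3),
§4.1 for BPP). Both completeness theorems are PROVED in the tree
(jonesApproxProblem_PromiseBQP_complete; aaronson_ambainis_kForrelation_complete_of_hard +
AaronsonAmbainis2018_lemma24_sign_hard_holds), so 'X ⟺ Jones ∉ prBPP ⟺ Forrelation ∉ prBPP' are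
provable-now supports and the summit is EXACTLY X ∧ PL (S → X: PlConverseR; S → PL vacuous; X ∧ PL →
S: closes). The price and the content of the line is the lift PL, the quantum analogue of
Goldreich's open 'BPP = P ⟹ prBPP = prP?' (Goldreich2011 §6 fn 27) and of Aaronson–Arkhipov's
distinction 'P = BQP' vs 'PromiseP = PromiseBQP' (AaronsonArkhipov2013 §10 (9)–(10); Aaronson2010
p.3: promise advantage without language advantage is 'entirely possible'). PL has exactly one known
non-vacuous road: the complete-language statement #3 (PromiseBQP ⊆ promiseLift BQP, equivalently
pseudo-deterministic quantum amplitude estimation — card canonical-solutions-lift, transplanting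
DPWV22 doi:10.1145/3519935.3520043 Thm 4.1 and arXiv:2602.17647 Thm 1.7) and its concrete face #4 (a
BQP language sandwiched between the AJL yes/no sets), a CONSTRUCTION problem about one algebraic
object (values in ℤ[ζ₅] of a unitary braid-group representation), not a lower bound. What changed at
rev 5 (2026-08-16): the tree now PROVES that PL does not relativize —
Literature.Barriers.QuantumAdvantage.PromiseLiftRelativization.holds exhibits A = K ⊕ G (brain
oracle of the Fortnow–Rogers world ⊕ Cohen generic) with BQP^A ⊆ AWPP^A = P^A ⊆ BPP^A and
PromiseBQP^A ⊄ PromiseBPP'^A, deciding Aaronson–Arkhipov's question (10) negatively for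
Fortnow–Rogers-type worlds; the same oracle kills every relativizing sufficient condition
(not_PromiseBQPRel_subset_promiseLift: #3 fails at A) — a theorem this route's kill test asked for.
So the line is certified to be 'X + a WHITE-BOX complete-language construction', and its unique
content is #4. Imported areas: low-dimensional topology/TQFT (faces of X and PL), Boolean Fourier
analysis (Forrelation face), structural complexity of promise classes
(Even–Selman–Yacobi/Goldreich), generic-oracle method (the barrier). No other route of the summit
isolates PL or the complete-language question (the crux chain on the shared item PlLift —
Cruxes/PlLift/Obstructions.md (c) — concludes 'PlLift proper stays what PromiseLift says it is: the
complete-language problem for BQP'); the negatives index (5 refuted statements: SpinorFlattening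
1244, CubicStability 2202, KummerSector 1615, SeparableFrames 9863, ShorLocallyDark 8592) is not
touched by any item here.
RANKED CRUXES. #0 PlThesis (X; auto-crux, conjecture-grade) — ¬(PromiseBQP ⊆ PromiseBPP') (why it
might fail: false iff PromiseBQP ⊆ prBPP, which P = PP gives; ≥ 'PP ⊄ BPP'-hard, needs a
non-relativizing non-algebrizing proof; sources BQP_subset_PP, SeparationPrerequisites,
Relativization, Algebrization, Watrous2009, GoldreichPromise2006) — STAFFING NOTE: X is the summit
in promise form; do not open a crux lineage on X before #4/#3 have been worked; its provable-now
faces are supports. #2 PlLift — BQP ⊆ BPP → PromiseBQP ⊆ PromiseBPP' (why it might fail: PL ≡ (X →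
S) is FALSE relative to the in-tree oracle K ⊕ G (PromiseLiftRelativization.holds), so it has no
relativizing proof, and the abstract semantic lifting schema behind it is false outright
(Cruxes/PlLift/Disproof.lean not_semanticLiftSchema: a machine with acceptance 1/2 somewhere);
unrelativized it fails iff advantage is promise-only (BQP ⊆ BPP ∧ X), a world nobody excludes;
classical analogue open (Goldreich2011 §6); ¬PL refutes the summit (not_plLift_iff), so it is
unrefutable in practice; sources Goldreich2011, AaronsonArkhipov2013 §10, Aaronson2010 p.3,
FortnowRogers1999 Cor 3.7, PromiseLiftRelativization). Shared by 7 routes; its crux chain runs under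
route CubicForrelation (primary) and has produced Obstructions B1–B3 and two exact-slice bypass
ideas (rm-distance-top-rigidity, rm-rigidity-exact-slice) that reach S, hence PL vacuously, for
non-universal families — they do not prove PL's non-vacuous content. #3 PlPromiseIsLift — PromiseBQP
⊆ promiseLift BQP, i.e. PromiseBQP = promiseLift BQP (library: promiseLift_BQP_subset_promiseBQP),
i.e. BQP has a PromiseBQP-complete language (why it might fail: fails relative to K ⊕ G
(not_PromiseBQPRel_subset_promiseLift) and BQP has no BPP-hard sets relative to another oracle
(FortnowRogers1999 Cor 3.11) — needs white-box structure; no complete language for any semantic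
class is known (AroraBarak2009 §7.5.3, GoldreichPromise2006 §4.1); true if P = PSPACE, hence
unrefutable outright). Provably EQUIVALENT to #4 given the in-tree completeness (refuter P.lean
plPromiseIsLift_iff_plJonesExtends; route review OBJECTION A: 'one content in two typings') and to
pseudo-deterministic QAPEP (card canonical-solutions-lift): kept as the abstract typing other routes
can want and refuters can negate by name, but it is ONE statement with three faces — never two
parallel lineages; a tenure pass may drop #3 in favour of #4 alone if staffing ever double-books
them. #4 PlJonesExtends — jonesApproxProblem ∈ promiseLift BQP: some L ∈ BQP contains every AJL
yes-instance ⟨n, b, θ, prec⟩ (|V_b(e^{2πi/5})|/Δ ≥ θ + 1/prec) and no no-instance (≤ θ) (why it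
might fail: normalised AJL values are 2^{-Ω(m)}-dense in the decision range — value-affine hardness
qSimSign_polyTimeReducible_jonesApprox + dyadic coin gadgets, Obstructions B2 — so NO
instance-independent threshold/window separates; sharp value thresholds are #P-hard at r = 5
(Kuperberg arXiv:0908.0512 Thm 1.2); a separating L is a canonical ROUNDING of the value computed
with an everywhere-gap (pseudo-determinism) or a non-value syntactic invariant of the braid word —
no mechanism known; sources AharonovJonesLandau2009 Thm 1.2, AharonovArad2011 Thm 1.1/3.1,
FreedmanLarsenWang2002, Kuperberg2015, Cruxes/PlLift/Obstructions.md B1–B2). THE LOAD-BEARING CRUX: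
the barrier entry itself names 'a BQP language separating the AJL problem built from the
ℤ[ζ₅]-arithmetic of the path-model representation' as the only evasion shape in view. Work order for
lineages: #4 first (all route-specific content), #3 only as the abstract/pd-QAPEP face of the same
lineage, #2 via its shared chain, X last.
KILL CRITERIA. (i) FIRED 2026-08-15/16 in its relativized form, as this route predicted and as the
route review (refuter rreview1, OBJECTION B) established on paper first: the relativized ¬PL (oracle
with BQP ⊆ BPP and PromiseBQP ⊄ PromiseBPP') is now the in-tree theorem
PromiseLiftRelativization.holds. Consequences RECORDED: #2/#3 and the glue #4 → #2 are certified
non-relativizing; every relativizing / black-box-in-the-circuit / value-window mechanism for them is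
dead (Obstructions B1–B2, Disproof.lean §2); the route is DEMOTED IN WORDS to 'reformulation (S ⟺ X
∧ PL, proved) + one white-box construction problem (#4 ⟺ #3)' — it stands or falls with WHITE-BOX
constructions for #4 (or the pd-QAPEP face of #3). The rev-3 pre-registration ('demote to
reformulation-only and close conditional-complete once the support items have landed') is honoured
as follows: the support layer has NOT landed (prover gate closed; candidate proofs P.lean attached),
so no close today; the tenure pass that sees 0249/0307/0308/0472/0545/11233/11234/11237/11238 proved
AND the first crux-ideation/triage round on #4 report decides — close `--as closed` with note
'conditional-complete: S ⟺ X ∧ PL banked as theorems; PL/#3 non-relativizing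
(PromiseLiftRelativization); no white-box line for #4 survived triage' if that is the report, keep
open if a #4 line passes triage. (ii) Independently, CLOSE exhausted if the crux chain on #4 parks
with no line after two ideation rounds (crux-parked-no-line) AND #3's pd-QAPEP face has no line
either — census: 'complete-language problem for BQP; relativized false; no white-box mechanism
found'. (iii) CLOSE refuted:<Decl> on a kernel ¬PlPromiseIsLift / ¬PlJonesExtends (a P ≠
PSPACE-strength theorem — not expected) or on ¬PlThesis (PromiseBQP ⊆ prBPP proved: closes the
summit's positive side with it). (iv) A no-go extending B2 to ALL separating languages of
value-affine-complete families (e.g. 'every L separating jonesApproxProblem is PP-hard', making #4 ⟹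
PP ⊆ BQP) demotes #4 to implausible → close exhausted with that theorem banked as a barrier. (v) S
proved by another route makes PL vacuous (QuantumAdvantage → PlLift, one line: Disproof.lean
plLift_of_quantumAdvantage) → close superseded --by that route; X then follows from S (PlConverseR).
(vi) PromiseBPP' shown mistyped against textbook prBPP → re-file the faces with the fix (closure and
ofLanguage lemmas are proved; unlikely).
NOT DECOMPOSED YET. No split is filed. For #4 the rev-3 candidate child (a) 'value-free window
around a computable point t(n, m, θ)' is WITHDRAWN — dead by B2 (values dense at every
instance-independent point); what remains for a line on #4, to come from its crux-ideation, not from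
this header: (b) CANONICAL ROUNDING — an everywhere-gapped uniform family computing a canonical
1/prec-rounding of |V_b|/Δ (pseudo-deterministic amplitude estimation for the AJL family = card
canonical-solutions-lift specialised; note θ and prec are INPUTS of jonesApproxProblem, so a
separating L is exactly a consistent cut θ ↦ L(b, θ, prec) switching inside (v − 1/prec, v]); (c)
NON-VALUE SYNTACTIC INVARIANTS — BQP-decidable predicates of the braid word b (exact ℤ[ζ₅]
congruence / Galois-conjugate data of the path-model matrix element, in tree: JonesReduction.lean,
PathModel*.lean) that happen to contain yes and avoid no; (d) gap relocation by
padding/self-reduction (make the free window land where the instance says). The Forrelation face of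
#4 (kForrelationProblem ∈ promiseLift BQP; equivalent to #3 by the one-line Forrelation
completeness) is deliberately not a fifth crux (same statement, second face); a tenure pass may swap
faces if the Fourier side shows traction (exact slices are where rigidity lives: Cruxes/PlLift/Ideas
rm-*). Relativized promise classes now EXIST in the tree (PromiseClassesRel.lean: PromiseBQPRel,
PromiseBPP'Rel) — the rev-3 definition request is discharged. needs-fact: NONE — deps.unproved = ∅
over 118 project constants (gate, 2026-08-15T16:57Z; unchanged at rev 4).
CHEAPEST FALSIFIER. (1) DONE: the relativized test of PL named here at rev 3 (does the
Fortnow–Rogers/FFKL generic collapse also collapse the promise classes?) was run by the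
disprover/barrier seats and answered NO — PromiseLiftRelativization.holds (K ⊕ G: P = AWPP ⊇ BQP, PH
infinite, PromiseBQP ⊄ PromiseBPP'); outcome = kill criterion (i), recorded above. (2) NEXT, for
#4's remaining lines, provable now at support level from in-tree reductions: AJL VALUE DENSITY — for
every n-strand length-m regime and every rational t in the decision range there are valid braids b±
with |V_{b±}|/Δ within 2^{-Ω(m)} of t on both sides (value-affine encoding of dyadic-coin circuits
through qSimSign_polyTimeReducible_jonesApprox); this is Obstructions B2 made a theorem for the AJL
family and retires every threshold/window proposal for #4 before a lineage spends on it. (3) For the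
support layer: lean check of the refuter's P.lean against the live rev-4 module (2026-08-15T18:29Z:
rc 0, 0 sorry, axioms propext/Classical.choice/Quot.sound for 0249, 11233, 0307, 0308, 0472, 0545,
11234, 11237, 11238 and #3 ↔ #4).
TWO-LAYER PLAN. Foreseen only, nothing filed: PlLift ⇐ PlPromiseIsLift (crux #3 + support glue
PlLiftOfPromiseIsLift, proved: h.trans ((promiseLift_mono hc).trans
PromiseBPP_subset_PromiseBPP'_holds)); PlPromiseIsLift ⇐ PlJonesExtends (crux #4 + support glue
PlPromiseIsLiftOfJonesExtends, proved: pull L back along flw_jonesApproxProblem_hard_holds, BQP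
closed under Karp reductions by mem_PromiseBQP_of_polyTimeReducible). A genuine split of #4 (k ≤ 3)
waits for a line from its crux chain; (b)/(c)/(d) above are candidate LINES, not children.
NUMBERS. AJL: t = e^{2πi/5}, d = 2cos(π/5) ≈ 1.618, Δ = d^{n/2−1}; in-tree reduction lands QSIM-sign
instances at θ = 3/10, prec = 4 (yes ≥ 11/20, no ≤ 3/10) on 4n strands; Forrelation gap 3/5 vs 1/100
(AaronsonAmbainis2018 Prop 6); query shadow of ¬PL: D(f) ≤ 4096·Q₂(f)⁶ for total f (BealsEtAl2001
Thm 5.4) vs 1 vs Ω̃(√N) for Forrelation; Kuperberg: value thresholds #P-hard at r = 5.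
SOURCES. AharonovJonesLandau2009 (arXiv:quant-ph/0511096), AharonovArad2011
(arXiv:quant-ph/0605181), FreedmanLarsenWang2002 (arXiv:quant-ph/0001108), AaronsonAmbainis2018
(arXiv:1411.5729), Kuperberg2015 (arXiv:0908.0512), WocjanZhang2006 (arXiv:quant-ph/0606179),
Zhang2012 (doi:10.1007/978-3-540-92910-9_46), GoldreichPromise2006 (doi:10.1007/11685654_12),
Goldreich2011 (doi:10.1007/978-3-642-22670-0_20), AroraBarak2009 §7.5.3, Aaronson2010
(arXiv:0910.4698), AaronsonArkhipov2013 (doi:10.4086/toc.2013.v009a004), FortnowRogers1999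
(arXiv:cs/9811023), FennerFortnowKurtzLi2003 (Inform. Comput. 182, Thm 6.18), RazTal2022 (J. ACM
69), DPWV22 (doi:10.1145/3519935.3520043), AGL26 (arXiv:2602.17647), Watrous2009 (arXiv:0804.3401);
in tree: Literature.Barriers.QuantumAdvantage.PromiseLiftRelativization,
Cruxes/PlLift/Disproof.lean, Cruxes/PlLift/Obstructions.md, route evidence
RouteReview_PromiseLift.md + P.lean (refuter rreview1, 2026-08-15).
DEFINITION REQUESTS. None open: jonesApproxProblem, kForrelationProblem, promiseLift, PromiseBPP',
PromiseBQPRel/PromiseBPP'Rel all exist in the tree.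

Novelty: Searches (2026-08-14 by rev 1–3 planners: lit search / hybrid / vsearch / frontier on 'promise BQP
language collapse', 'BQP complete language', 'Jones polynomial BQP-complete', 'pseudo-deterministic
quantum'; refreshed 2026-08-16: lit search --hybrid "BQP complete language promise problem complete
problems for BQP semantic class" (8 book hits: AroraBarak2009 pp.301/593, Goldreich in
book:editornd-theoretical-computer-science pp.286–307, HomerSelman2011), lit search --source all
"promise problems BQP complete language Jones polynomial approximation BQP-complete" (19 merged:
quant-ph/0605181, quant-ph/0606179, quant-ph/0511096, 0707.2831, doi:10.1007/978-3-540-92910-9_46,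
doi:10.1145/1806689.1806711; openalex 429), in-tree barrier catalogue and Cruxes/PlLift/ read in
full).
Nearest prior art found: (1) PromiseBQP-completeness of X's faces — Jones plat closure at e^{2πi/5}:
AharonovJonesLandau2009 (arXiv:quant-ph/0511096 Thm 1.2/1.3), FreedmanLarsenWang2002
(arXiv:quant-ph/0001108), AharonovArad2011 (arXiv:quant-ph/0605181 Thm 1.1/3.1), Kuperberg
arXiv:0908.0512, Shor–Jordan arXiv:0707.2831 (trace closure: DQC1-complete only); poly-fold
Forrelation: AaronsonAmbainis2018 (arXiv:1411.5729 Prop 6, Thm 25); further promise-complete lists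
WocjanZhang arXiv:quant-ph/0606179, Zhang 2012 doi:10.1007/978-3-540-92910-9_46 — all PROMISE
problems, all used only as named facts (two proved in tree). (2) Language→promise collapse:
classical version OPEN, Goldreich2011 (doi:10.1007/978-3-642-22  [refs: 10.1007/978-3-540-92910-9_46, 10.1145/1806689.1806711, 10.1007/978-3-642-22670-0_20, 10.4086/toc.2013.v009a004, 10.1145/3519935.3520043, quant-ph/0511096, quant-ph/0001108, quant-ph/0605181, 0908.0512, 0707.2831, 1411.5729, quant-ph/0606179, 0910.4698, 2111.10409, 2602.17647, book:editornd-theoretical-computer-science, doi:10.1007/978-3-540-92910-9_46, doi:10.1145/1806689.1806711, doi:10.1007/978-]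

Barriers (technique_class: class-separation; promise-completeness; promise-lift): - technique_class: class-separation; promise-completeness; promise-lift (white-box construction for
#4)
- Literature.Barriers.QuantumAdvantage.PromiseLiftRelativization: APPLIES (in-tree theorem, status
established) to #2 PlLift, to #3 PlPromiseIsLift and to the glue #4 → #3 → #2 — relative to A = K ⊕
G, BQP^A ⊆ BPP^A while PromiseBQP^A ⊄ PromiseBPP'^A and PromiseBQP^A ⊄ promiseLift BQP^A
(not_relativizes_promiseLift, not_PromiseBQPRel_subset_promiseLift); NOT evaded by anything
relativizing, nor by black-box-in-the-circuit devices (Cruxes/PlLift/Obstructions.md B1: acceptance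
functionals are continuous in the unitary, languages are projections) nor by value windows for
complete families (B2: values dense). The bet is exactly the evasion the entry lists
(evasions_known): a WHITE-BOX BQP language separating ONE complete problem — #4, built from the
syntactic braid word / ℤ[ζ₅] path-model arithmetic (canonical rounding with an everywhere-gap, or a
non-value invariant); its unrelativized content is untouched by the oracle (scope caveat (c)).
- Literature.Barriers.QuantumAdvantage.SeparationPrerequisites: APPLIES to the crux X = PlThesis,
NOT evaded — every PromiseBQP family extends to a PP language (GapP sign, BQP_subset_PP pattern), so
X ⇒ PP ⊄ BPP ⇒ P ≠ PP, P ≠ PSPACE exactly as for the summit; the bet is only that completeness pins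
the separation on ONE structured problem. PL, #3, #4 have no such consequence (implied by P =
PSPACE).
- Literature.Barriers.QuantumAdvantage.Rela

History (route lifecycle, newest last):
- 2026-08-15T16:55:46Z · rev 3: restated PlConverse (stmt-QuantumAdvantage-0251), PlXIffKForrelationNotPromiseBPP (stmt-QuantumAdvantage-0537) — route-repair (rbadge g2, 2026-08-15): REROUTED + GLUE + FLOOR. (a) cone: import ForrelationComplete dropped; 0537 restated with the Forrelation-completeness hyp (planner-rbadge-QuantumAdvantage-PromiseLift-ce44ee3d-g2-0)
- 2026-08-16T04:15:10Z · AUTO-CRUX (backfill): PlThesis — hypotheses of the deciding theorem that nothing in the route derives are cruxes (operator:999:1085951)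
- 2026-08-24T12:28:52Z · DORMANT — reconciler: no traction for 6.8 d (last activity item-evidence-added at 2026-08-17T17:20:32Z); parked, not closed — `ledger route dormant route-QuantumAdvantage (operator:999:1463033)
- 2026-08-29T10:35:21Z · REACTIVATED — reconciler: reactivated — activity statement-checked at 2026-08-29T09:00:29Z after parking at 2026-08-24T12:28:52Z (operator:999:2754606)

sub-problem: QuantumAdvantage · status: open · opened planner-QuantumAdvantage-Survey-0 2026-08-13T06:04:28Z · rev 8 · ledger route-QuantumAdvantage-PromiseLift
GENERATED by the gate from the ledger (D-0016/17). Provers cite these decls: `theorem foo : Summit.QuantumAdvantage.QuantumAdvantage.Theses.PromiseLift.<Decl> := …` in Summits/QuantumAdvantage/QuantumAdvantage/Theorems/<Name>.lean.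
-/

namespace Summit.QuantumAdvantage.QuantumAdvantage.Theses.PromiseLift

open scoped BigOperators Topology Manifold Classical MeasureTheory ProbabilityTheory Matrix InnerProductSpace ComplexConjugate ContinuousMap
open Filter Set Function TopologicalSpace MeasureTheory

attribute [summit_statement] _root_.QuantumAdvantage

open Literature.QuantumAdvantage

/-- item stmt-QuantumAdvantage-0248 · crux (kind.auto-crux: conjecture-grade) · rank 0 · open · by planner
why it might fail: X is FALSE iff PromiseBQP ⊆ prBPP, which P = PP gives (PromiseBQP ⊆ promiseLift PP by GapP; promiseLift P ⊆ PromiseBPP'): X is ≥ 'PP ⊄ BPP'-hard and needs a non-relativizing, non-algebrizing proof (a PSPACE-complete oracle collapses the promise classes too); none is known.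
sources: Literature.Computability.QuantumComplexity.BQP_subset_PP (AdlemanDeMarraisHuang1997; FortnowRogers1999 = arXiv:cs/9811023 Cor 3.5), Literature.Barriers.QuantumAdvantage.SeparationPrerequisites (not_PP_subset_BPP_of_witness, P_ne_PSPACE_of_witness), Literature.Barriers.QuantumAdvantage.Relativization (Relativization.not_relativizes_either), Literature.Barriers.QuantumAdvantage.Algebrization (AaronsonWigderson2008 Thm 5.2), Watrous2009 = arXiv:0804.3401 p.5, p.10 (PromiseBPP', PromiseBQP = BQP(2/3,1/3) over promise problems), GoldreichPromise2006 = doi:10.1007/11685654_12 Def. 2 p.283, §1.3(3) p.286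
Thesis X of route PromiseLift: some promise problem solved with gap (2/3,1/3) by a uniform
Clifford+T family is not solved with gap by any probabilistic poly-time machine (textbook prBPP =
Literature.Computability.Complexity.PromiseBPP', NOT the stronger promiseLift class PromiseBPP).
Equivalent, by PromiseBQP-completeness, to 'Jones-polynomial additive approximation at e^{2πi/5} ∉
prBPP' and to 'poly-fold white-box FORRELATION ∉ prBPP'. [Watrous2009 §III.2; Goldreich2006 Def.
1.2; AharonovJonesLandau2009; AaronsonAmbainis2018] -/
@[route_item "route-QuantumAdvantage-PromiseLift", crux]
def PlThesis : Prop :=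
  ¬ (Literature.Computability.Cryptography.PromiseBQP ⊆ Literature.Computability.Complexity.PromiseBPP')

/-- item stmt-QuantumAdvantage-0250 · crux · rank 2 · open · by planner
why it might fail: PL ≡ (X→S) is FALSE relative to the in-tree oracle K⊕G (PromiseLiftRelativization.holds: BQP⊆BPP but PromiseBQP⊄PromiseBPP' there) ⇒ no relativizing proof; the abstract semantic lift is false (not_semanticLiftSchema); unrelativized it fails iff advantage is promise-only; classical analogue open.
sources: Literature.Barriers.QuantumAdvantage.PromiseLiftRelativization (PromiseLiftRelativization.holds, not_relativizes_promiseLift; landed 2026-08-15/16), Summits/QuantumAdvantage/QuantumAdvantage/Cruxes/PlLift/Disproof.lean (not_plLift_iff, not_semanticLiftSchema), Goldreich2011 = doi:10.1007/978-3-642-22670-0_20 §6 p.28 fn 27 (classical lift OPEN), AaronsonArkhipov2013 = doi:10.4086/toc.2013.v009a004 §10 (9)-(10) p.236, Aaronson2010 = arXiv:0910.4698 p.3, FortnowRogers1999 = arXiv:cs/9811023 Cor 3.7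
OPEN structural question (analogue of 'P = BPP ⇒ prP = prBPP?', Goldreich2011 §1): does equality of
the language classes force equality of the textbook promise classes? The obstruction: a PromiseBQP
family has no acceptance gap off the promise, so its threshold set is not a BQP language. Most
informative crux of the route: a proof makes every PromiseBQP-completeness result (Jones,
Forrelation) a bona fide reformulation of BQP ≠ BPP; a relativized counterexample would explain why
decision-level quantum advantage evidence is scarce. [Goldreich2006 §1.2; Goldreich2011; Watrous2009
§III.2] -/
@[route_item "route-QuantumAdvantage-PromiseLift", crux]
def PlLift : Prop :=
  Literature.Computability.Cryptography.BQP ⊆ Literature.Computability.Complexity.BPP → Literature.Computability.Cryptography.PromiseBQP ⊆ Literature.Computability.Complexity.PromiseBPP'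

/-- item stmt-QuantumAdvantage-11235 · crux · rank 3 · open · by planner
why it might fail: Fails relative to K⊕G (not_PromiseBQPRel_subset_promiseLift) and BQP has no BPP-hard sets relative to another oracle (FortnowRogers1999 Cor 3.11): needs white-box structure; no complete LANGUAGE for a semantic class is known (AroraBarak2009 §7.5.3); true if P = PSPACE, so unrefutable outright.
sources: Literature.Barriers.QuantumAdvantage.PromiseLiftRelativization (not_PromiseBQPRel_subset_promiseLift), FortnowRogers1999 = arXiv:cs/9811023 p.6 Cor 3.11, AroraBarak2009 §7.5.3 (PDF pp.168-169), GoldreichPromise2006 §4.1 p.293, §1.3(3) p.286, DPWV22 = doi:10.1145/3519935.3520043 Thm 4.1; AGL26 = arXiv:2602.17647 Thm 1.7 (pd-QAPEP face; card canonical-solutions-lift), tree: Literature.Computability.Complexity.promiseLift_BQP_subset_promiseBQP (converse inclusion)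
[crux] PromiseBQP IS THE PROMISE LIFT OF BQP: every promise problem solved with gap (2/3, 1/3) by a
uniform Clifford+T family is SEPARATED by some BQP language L (Q.yes ⊆ L, Q.no ⊆ Lᶜ), i.e.
PromiseBQP ⊆ promiseLift BQP; with the library's promiseLift_BQP_subset_promiseBQP this is
PromiseBQP = promiseLift BQP, and by the in-tree Jones completeness it says that BQP has a
PromiseBQP-complete LANGUAGE (the first complete language for the semantic class BQP). It implies
the lift PL (#2) outright: BQP ⊆ BPP ⟹ promiseLift BQP ⊆ promiseLift BPP = PromiseBPP ⊆ PromiseBPP'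
(support PlLiftOfPromiseIsLift, one line, provable now) — the only known NON-VACUOUS road to PL (S
gives PL vacuously). Equivalent to its concrete face #4 PlJonesExtends (support
PlPromiseIsLiftOfJonesExtends + the proved membership ajl_jonesApproxProblem_mem_PromiseBQP_holds).
A CONSTRUCTION problem, not a lower bound; it does not relativize (Fortnow–Rogers 1999 Cor. 3.11:
relative to some oracle BQP has no complete sets), so the construction must use white-box structure
of a specific complete promise problem — which is what #4 supplies. [deps: none] [difficulty:
open-problem] -/
@[route_item "route-QuantumAdvantage-PromiseLift"]
def PlPromiseIsLift : Prop :=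
  Literature.Computability.Cryptography.PromiseBQP ⊆ Literature.Computability.Complexity.promiseLift Literature.Computability.Cryptography.BQP

/-- item stmt-QuantumAdvantage-11236 · crux · rank 4 · open · by planner
why it might fail: AJL values are 2^{-Ω(m)}-dense in the decision range (value-affine hardness + dyadic coin gadgets: Obstructions B2) ⇒ no instance-independent threshold/window separates; sharp thresholds are #P-hard at r=5 (Kuperberg Thm 1.2); L must be a canonical rounding or a non-value invariant: no mechanism.
sources: AharonovJonesLandau2009 = arXiv:quant-ph/0511096 Thm 1.2, §3, AharonovArad2011 = arXiv:quant-ph/0605181 Thm 1.1/3.1, FreedmanLarsenWang2002 = arXiv:quant-ph/0001108, Kuperberg2015 = arXiv:0908.0512 Thm 1.2, Summits/QuantumAdvantage/QuantumAdvantage/Cruxes/PlLift/Obstructions.md (B1 continuity no-go, B2 universality-rigidity exclusion), tree: jonesApproxProblem_PromiseBQP_complete (JonesReductionHolds.lean), qSimSign_polyTimeReducible_jonesApprox (JonesReduction.lean), mem_PromiseBQP_of_polyTimeReducible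
[crux] THE TQFT FACE OF THE LIFT: the Aharonov–Jones–Landau promise problem jonesApproxProblem
(braid word b ∈ B_n, threshold θ; YES |V_b(e^{2πi/5})|/Δ ≥ θ + 1/poly, NO ≤ θ, Δ = d^{n/2-1}) is the
restriction of a BQP LANGUAGE: ∃ L ∈ BQP with yes ⊆ L and no ⊆ Lᶜ, i.e. jonesApproxProblem ∈
promiseLift BQP. Because the problem is PromiseBQP-complete — PROVED in the tree
(jonesApproxProblem_PromiseBQP_complete: AJL membership + FLW/Aharonov–Arad hardness via
Aaronson–Ambainis Lemma 24) — this single extension gives #3 for ALL of PromiseBQP (support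
PlPromiseIsLiftOfJonesExtends: pull L back along the Karp reductions, BQP being closed under them by
mem_PromiseBQP_of_polyTimeReducible; provable now, 8 lines) and hence PL. Relativized, no such
language need exist (Fortnow–Rogers 1999 Cor. 3.11), so the ℤ[ζ₅]/density structure is load-bearing.
The task is constructive: find a total, bounded-error-quantum-decidable refinement of the AJL
threshold using the exact ℤ[ζ₅]-arithmetic of the path-model representation (in tree:
JonesReduction.lean, PathModel*.lean) — e.g. a computable point t(n,m,θ) inside the gap with a
value-free window around it. [deps: none; implies PlPromiseIsLift] [difficult -/
@[route_item "route-QuantumAdvantage-PromiseLift"]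
def PlJonesExtends : Prop :=
  Literature.Computability.QuantumComplexity.jonesApproxProblem ∈ Literature.Computability.Complexity.promiseLift Literature.Computability.Cryptography.BQP

/-- item stmt-QuantumAdvantage-0307 · support · rank 3 · open · by planner
Let jonesApproxProblem : PromiseProblem encode: input a braid word b ∈ B_n (generators σ_i^{±1}) of
length m and a rational threshold pair; with V the Jones polynomial of the plat closure of b at t =
e^{2πi/5}, d = 2cos(π/5), Δ = d^{n/2-1}: YES if |V|/Δ ≥ θ + 1/poly, NO if |V|/Δ ≤ θ. CLAIM: (i)
jonesApproxProblem ∈ Literature.Computability.Cryptography.PromiseBQP [AharonovJonesLandau2009 Thms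
1.1–1.2 (path-model representation of the Temperley–Lieb algebra, Hadamard test)]; (ii) every Π ∈
PromiseBQP Karp-reduces in polynomial time to jonesApproxProblem [FreedmanLarsenWang2002 (density of
the Jones representation for k = 5); AharonovArad2011 main theorem, §1 (explicit BQP-hardness for
all k ≥ 5, k ≠ 6, also k = poly(n))]. Consequence: X ↔ jonesApproxProblem ∉ PromiseBPP'. Imports
low-dimensional topology / TQFT (FreedmanKitaevWang2002). NEEDS DEFINITIONS: braid words, Kauffman
bracket / Jones polynomial of a plat closure (Mathlib has neither), jonesApproxProblem.
[needs_definition: jonesApproxProblem] -/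
@[route_item "route-QuantumAdvantage-PromiseLift"]
def PlJonesComplete : Prop :=
  Literature.Computability.QuantumComplexity.jonesApproxProblem ∈ Literature.Computability.Cryptography.PromiseBQP ∧ ∀ Q ∈ Literature.Computability.Cryptography.PromiseBQP, Q.PolyTimeReducible Literature.Computability.QuantumComplexity.jonesApproxProblem

/-- item stmt-QuantumAdvantage-0308 · support · rank 4 · open · by planner
Let kForrelationProblem : PromiseProblem be: input Boolean circuits C_1..C_k on n inputs (k =
poly(n), given explicitly), f_i = (−1)^{C_i}; Φ = 2^{-(k+1)n/2} Σ_{x_1..x_k} f_1(x_1) (−1)^{x_1·x_2}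
f_2(x_2) ⋯ (−1)^{x_{k-1}·x_k} f_k(x_k); YES if Φ ≥ 3/5, NO if |Φ| ≤ 1/100. CLAIM:
kForrelationProblem ∈ PromiseBQP (H^{⊗n}, phase queries realised by running the circuits reversibly)
and is PromiseBQP-hard under Karp reductions for k = poly(n) [AaronsonAmbainis2018 §1.2 result
'k-fold Forrelation is BQP-complete for k = poly(n)', proved in the section on k-fold Forrelation].
Consequence: X ↔ kForrelationProblem ∉ PromiseBPP'. Imports Boolean Fourier analysis (RazTal2022 for
the AC⁰ lower bound on the black-box version). NEEDS DEFINITION: kForrelationProblem (white-box;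
uses G01 Circuit encodings).  [needs_definition: kForrelationProblem] -/
@[route_item "route-QuantumAdvantage-PromiseLift"]
def PlForrelationComplete : Prop :=
  Literature.Computability.QuantumComplexity.kForrelationProblem ∈ Literature.Computability.Cryptography.PromiseBQP ∧ ∀ Q ∈ Literature.Computability.Cryptography.PromiseBQP, Q.PolyTimeReducible Literature.Computability.QuantumComplexity.kForrelationProblem

/-- item stmt-QuantumAdvantage-11233 · support · rank 5 · open · by planner
[support] S ⟹ X (repair 2026-08-15: restated WITHOUT the unused hypothesis BPP_subset_BQP, which
dragged an env-invisible named fact into the cone). From a witness L ∈ BQP ∖ BPP: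
PromiseProblem.ofLanguage L ∈ PromiseBQP (ofLanguage_mem_PromiseBQP_iff); if PromiseBQP ⊆
PromiseBPP' then ofLanguage L ∈ PromiseBPP', i.e. L ∈ BPP (ofLanguage_mem_PromiseBPP'_iff,
PromiseZPPProofs.lean) — contradiction. Shows X is NECESSARY for S, so PL (#2) is exactly the
missing sufficiency and S ⟺ X ∧ PL. Provable now (3 lines; planner's Proofs.lean `plConverseR`).
[Goldreich2006 Def. 1.2; Watrous2009 §III.2] -/
@[route_item "route-QuantumAdvantage-PromiseLift"]
def PlConverseR : Prop :=
  QuantumAdvantage → ¬ (Literature.Computability.Cryptography.PromiseBQP ⊆ Literature.Computability.Complexity.PromiseBPP')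

/-- item stmt-QuantumAdvantage-0472 · support · rank 6 · open · by planner
Glue turning PromiseBQP-completeness (#3 0307 jonesApproxProblem, #4 0308 kForrelationProblem, both
now with signatures `Π ∈ PromiseBQP ∧ ∀ Q ∈ PromiseBQP, Q.PolyTimeReducible Π`) into the
equivalences X ↔ jonesApproxProblem ∉ PromiseBPP' ↔ kForrelationProblem ∉ PromiseBPP'. Proof: given
f ∈ FP (yes→yes, no→no) and (L' ∈ P, p) witnessing Q₂ ∈ PromiseBPP', take a polynomial p' with
p'(|x|) ≥ p(|f x|) (FP output-length bound) and L'' = {boolPair x y : boolPair (f x) (y.take (p (f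
x).length)) ∈ L'} ∈ P; uniformProb over {0,1}^{p'(|x|)} of an event depending only on the
length-p(|f x|) prefix equals the prefix probability. Goldreich2006 §1.1 / Def. 1.4 (closure of
promise classes under Karp reductions); textbook. -/
@[route_item "route-QuantumAdvantage-PromiseLift"]
def PlPromiseBPPClosedUnderReductions : Prop :=
  ∀ Q₁ Q₂ : Literature.Computability.Complexity.PromiseProblem, Q₁.PolyTimeReducible Q₂ → Q₂ ∈ Literature.Computability.Complexity.PromiseBPP' → Q₁ ∈ Literature.Computability.Complexity.PromiseBPP'

/-- item stmt-QuantumAdvantage-11234 · support · rank 7 · open · by planner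
[support] USE-SITE form of the Forrelation face (repair 2026-08-15: the PromiseBQP-completeness of
explicit poly-fold FORRELATION is now an INLINED hypothesis — literally the signature of
PlForrelationComplete (0308) — instead of the named fact aaronson_ambainis_kForrelation_complete,
which kept the cone unproved; that fact is itself one line from landed pieces:
aaronson_ambainis_kForrelation_complete_of_hard AaronsonAmbainis2018_lemma24_sign_hard_holds).
CLAIM: under the hypothesis, X = ¬(PromiseBQP ⊆ PromiseBPP') ↔ kForrelationProblem ∉ PromiseBPP' (no
prBPP machine estimates the poly-fold forrelation of white-box B₂-circuits across the 3/5 vs 1/100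
gap). Proof, provable now (1 line): PromiseProblem.not_subset_PromiseBPP'_iff_of_complete_holds h.1
h.2 (PromiseBPPClosureProofs.lean). [AaronsonAmbainis2018 §1.2, §6 Prop. 6 / Thm. 25; Goldreich2006
§1.2 remark after Def. 3] -/
@[route_item "route-QuantumAdvantage-PromiseLift"]
def PlXIffKForrelationNotPromiseBPPR : Prop :=
  (Literature.Computability.QuantumComplexity.kForrelationProblem ∈ Literature.Computability.Cryptography.PromiseBQP ∧ ∀ Q ∈ Literature.Computability.Cryptography.PromiseBQP, Q.PolyTimeReducible Literature.Computability.QuantumComplexity.kForrelationProblem) → (¬ (Literature.Computability.Cryptography.PromiseBQP ⊆ Literature.Computability.Complexity.PromiseBPP') ↔ Literature.Computability.QuantumComplexity.kForrelationProblem ∉ Literature.Computability.Complexity.PromiseBPP')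

/-- item stmt-QuantumAdvantage-0545 · support · rank 8 · open · by planner
USE-SITE restatement of crux #3 (stmt-0307) now that its two conjuncts are DONE Literature facts:
wi-03991 `ajl_jonesApproxProblem_mem_PromiseBQP` (= jonesApproxProblem ∈ PromiseBQP;
AharonovJonesLandau2009 Thm 1.2) and wi-03997 `flw_jonesApproxProblem_hard` (= ∀ Q ∈ PromiseBQP,
Q.PolyTimeReducible jonesApproxProblem; FreedmanLarsenWang2002, AharonovArad2011 Thm 1.1), both
landing in Literature/Computability/QuantumComplexity/JonesInBQP.lean (queued at filing time). Per
D-0014 the crux is consumed as a hypothesis; the hypothesis is written as 0307's signature verbatim,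
which is definitionally `ajl_jonesApproxProblem_mem_PromiseBQP ∧ flw_jonesApproxProblem_hard` once
JonesInBQP.lean lands (a prover may then restate with the named constants; 0307 itself is left as
filed — proving it = discharging the two facts). CLAIM: under h, the route thesis X = ¬(PromiseBQP ⊆
PromiseBPP') is equivalent to jonesApproxProblem ∉ PromiseBPP', i.e. to: no BPP machine additively
approximates the Jones polynomial of the plat closure of a braid at e^{2πi/5} to the AJL precision.
Proof (provable now, ≤ 20 lines given #6 stmt-0472): (→) if jonesApproxProblem ∈ PromiseBPP' then
every Q ∈ PromiseBQP Karp-red -/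
@[route_item "route-QuantumAdvantage-PromiseLift"]
def PlXIffJonesNotPromiseBPP : Prop :=
  (Literature.Computability.QuantumComplexity.jonesApproxProblem ∈ Literature.Computability.Cryptography.PromiseBQP ∧ ∀ Q ∈ Literature.Computability.Cryptography.PromiseBQP, Q.PolyTimeReducible Literature.Computability.QuantumComplexity.jonesApproxProblem) → (¬ (Literature.Computability.Cryptography.PromiseBQP ⊆ Literature.Computability.Complexity.PromiseBPP') ↔ Literature.Computability.QuantumComplexity.jonesApproxProblem ∉ Literature.Computability.Complexity.PromiseBPP')

/-- item stmt-QuantumAdvantage-11237 · support · rank 9 · open · by planner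
sources: GoldreichPromise2006 §1.2 Def. 2, tree: Literature.Computability.Complexity.promiseLift_mono, PromiseBPP_subset_PromiseBPP'_holds
[support] GLUE #3 ⟹ #2 (PlPromiseIsLift → PlLift, both spelled out): if every PromiseBQP problem is
separated by a BQP language and BQP ⊆ BPP, then PromiseBQP ⊆ promiseLift BQP ⊆ promiseLift BPP =
PromiseBPP ⊆ PromiseBPP'. Provable now, one line: h.trans ((promiseLift_mono hc).trans
PromiseBPP_subset_PromiseBPP'_holds) (Promise.lean promiseLift_mono; PromiseZPPProofs.lean
PromiseBPP_subset_PromiseBPP'_holds); planner's Proofs.lean `plLiftOfPromiseIsLift`, axioms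
whitelist. [Goldreich2006 §1.2 (promise classes, strong vs textbook promise-BPP)] -/
@[route_item "route-QuantumAdvantage-PromiseLift"]
def PlLiftOfPromiseIsLift : Prop :=
  Literature.Computability.Cryptography.PromiseBQP ⊆ Literature.Computability.Complexity.promiseLift Literature.Computability.Cryptography.BQP → (Literature.Computability.Cryptography.BQP ⊆ Literature.Computability.Complexity.BPP → Literature.Computability.Cryptography.PromiseBQP ⊆ Literature.Computability.Complexity.PromiseBPP')

/-- item stmt-QuantumAdvantage-11238 · support · rank 9 · open · by planner
sources: AharonovArad2011 = arXiv:quant-ph/0605181 Thm 3.1, GoldreichPromise2006 §1.2 Def. 3 (Karp reductions among promise problems), tree: flw_jonesApproxProblem_hard_holds (JonesReductionHolds.lean), mem_PromiseBQP_of_polyTimeReducible (ClassBQPReductionProofs.lean)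
[support] GLUE #4 ⟹ #3 (PlJonesExtends → PlPromiseIsLift, both spelled out): let L ∈ BQP separate
jonesApproxProblem; for Q ∈ PromiseBQP take the in-tree Karp reduction f ∈ FP of Q to
jonesApproxProblem (flw_jonesApproxProblem_hard_holds, JonesReductionHolds.lean: FLW density +
Aharonov–Arad + Aaronson–Ambainis Lemma 24, all proved); then f⁻¹(L) separates Q, and f⁻¹(L) ∈ BQP
because ofLanguage (f⁻¹ L) reduces to ofLanguage L by f and PromiseBQP is closed under Karp
reductions of promise problems (mem_PromiseBQP_of_polyTimeReducible, ClassBQPReductionProofs.lean;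
ofLanguage_mem_PromiseBQP_iff). Provable now, 8 lines (planner's Proofs.lean
`plPromiseIsLiftOfJonesExtends`, axioms whitelist). The converse #3 ⟹ #4 is `h
ajl_jonesApproxProblem_mem_PromiseBQP_holds`. The hardness theorem is used in the PROOF,
deliberately not named in the statement (keeps the route cone on definitions only).
[AharonovArad2011 Thm 3.1; Goldreich2006 Def. 1.4; Watrous2009 §IV.3-4] -/
@[route_item "route-QuantumAdvantage-PromiseLift"]
def PlPromiseIsLiftOfJonesExtends : Prop :=
  Literature.Computability.QuantumComplexity.jonesApproxProblem ∈ Literature.Computability.Complexity.promiseLift Literature.Computability.Cryptography.BQP → Literature.Computability.Cryptography.PromiseBQP ⊆ Literature.Computability.Complexity.promiseLift Literature.Computability.Cryptography.BQP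

/-- item stmt-QuantumAdvantage-0249 · assembly · rank 1 · open · by planner
Contraposition with the posited lift hypothesis PL (= BQPCollapseLiftsToPromise, crux #2) as
explicit hypothesis. One line (BQP = BPP gives BQP ⊆ BPP). -/
@[route_item "route-QuantumAdvantage-PromiseLift"]
def Assembly : Prop :=
  (Literature.Computability.Cryptography.BQP ⊆ Literature.Computability.Complexity.BPP → Literature.Computability.Cryptography.PromiseBQP ⊆ Literature.Computability.Complexity.PromiseBPP') → ¬ (Literature.Computability.Cryptography.PromiseBQP ⊆ Literature.Computability.Complexity.PromiseBPP') → QuantumAdvantage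

-- records of items no longer active in this route (dropped / restated):
-- earlier PlConverse (stmt-QuantumAdvantage-0251, replaced 2026-08-15T16:55:46Z -> stmt-QuantumAdvantage-11233): retired by None — Literature.Computability.QuantumComplexity.BPP_subset_BQP → QuantumAdvantage → ¬ (Literature.Computability.Cryptography.PromiseBQP ⊆ Literature.Computability.Complexity.PromiseBPP')
-- earlier PlXIffKForrelationNotPromiseBPP (stmt-QuantumAdvantage-0537, replaced 2026-08-15T16:55:46Z -> stmt-QuantumAdvantage-11234): retired by None — Literature.Computability.QuantumComplexity.aaronson_ambainis_kForrelation_complete → (¬ (Literature.Computability.Cryptography.PromiseBQP ⊆ Literature.Computability.Complexity.PromiseBPP') ↔ Literature.Computability.QuantumComplexity.kForrelationProb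

/-! D-0027 §2.1 — DECIDING THEOREM (planner-authored via `route open/edit --closes-file`; by planner-rbadge-QuantumAdvantage-PromiseLift-ce44ee3d-g3-0 2026-08-16T05:18:08Z):
its hypotheses are this route's items and its conclusion the sub-problem Statement (glue_lint), and it elaborates with this file. -/

@[closes "route-QuantumAdvantage-PromiseLift"] theorem closes (hX : PlThesis) (hL : PlLift) : _root_.QuantumAdvantage := by
  by_contra hS
  exact hX (hL fun L hLBQP => Classical.by_contradiction fun hLBPP => hS ⟨L, hLBQP, hLBPP⟩)

end Summit.QuantumAdvantage.QuantumAdvantage.Theses.PromiseLift
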